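import Summits.SmoothPoincare4.SmoothPoincare4.Theses.EntropyRung
import Summits.SmoothPoincare4.SmoothPoincare4.Theses.RicciFat
import Summits.SmoothPoincare4.SmoothPoincare4.Theorems.SubcylindricalExistence.Negative.ConstTest
import Summits.SmoothPoincare4.SmoothPoincare4.Theorems.SubcylindricalExistence.Negative.Window
import Summits.SmoothPoincare4.SmoothPoincare4.Theorems.SubcylindricalExistence.Negative.Logic
import Literature.Geometry.Riemannian.RicciFlowScalarCurvatureProofs
import Literature.Geometry.Lorentzian.VolumeProofs
import Literature.Geometry.Riemannian.WeightedHeatFlowFromLinearHeat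
import HarnessLib

/-!
# Line `curvature-dimension-entropy-floor` for crux `EntropyRung.SubcylindricalExistence`
# (stmt-SmoothPoincare4-10871, "ENT")

Route `EntropyRung`, crux r5 `SubcylindricalExistence` = every closed smooth `M ≃ₕ S⁴` carries a
Riemannian metric `g` (with Levi-Civita connection) with `R > 0` and `ν(g) > ν_cyl`, typed
fact-free: `∃ δ > 0, ∀ τ > 0, ∀ f` smooth with `∫ (4πτ)⁻² e^{-f} dV = 1`,
`ν_cyl + δ ≤ 𝒲(g,f,τ) = ∫ [τ(R + |∇f|²) + f − 4](4πτ)⁻² e^{-f} dV`, `ν_cyl = log 2 + ½ log π − 3/2`.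

## The line (crux idea card `curvature-dimension-entropy-floor`, ideator 2; triage r1: 3 × pass,
## merged with `ricci-pinched-volume-transfer` as a second proof of Statement C)

LEVER. The curvature–dimension ENTROPY–ENERGY inequality EE(3,4) of Bakry–Émery `Γ₂`-calculus
(Statement B; Bakry–Gentil–Ledoux 2014 §6, quoted as eq. (4.1) of Bakry–Bolley–Gentil,
arXiv:1412.5165 p. 7): on a closed connected `(M⁴, g)` with `Ric ≥ 3g`, for the normalised volume
`m = dV/Vol` and `∫ w² dm = 1`, `Ent_m(w²) ≤ 2 log(1 + ⅓ ∫|∇w|² dm)`. Fed through the Legendre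
identity `𝒲(g,f,τ) = τ∫R u dV + 4τ E_m(w) − Ent_m(w²) + log Vol − 2 log(4πτ) − 4` (`u dV = w² dm`)
and `R = tr Ric ≥ 12`, the minimisation in `E` is explicit and the `τ`-dependence CANCELS:
THEOREM A (Statement C) `𝒲(g,f,τ) ≥ log Vol(M,g) − 2 log(2π/3) − 2` for all `τ, f`, i.e.
`ν(g) ≥ ν(S⁴_rd) + log(Vol/Vol S⁴)`, `ν(S⁴_rd) = log 6 − 2` — RoundBound for free, no Perelman
monotonicity. TRANSFER (Statement D = the card's `C⁺` at the FIXED `δ₀ = 1 − √(πe)/3 = 0.025906`,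
as all three triagers demanded — NOT the `∀ δ` statement `RicciFat.RicciFatSphere`, which is
`⇔ SPC4` by Cheeger–Colding): every closed smooth `M ≃ₕ S⁴` carries `g` with `Ric ≥ 3g` and
`Vol(M,g) > (√(πe)/3)·(8π²/3) = 25.6371`. Then `R ≥ 12 > 0` and, with
`δ_ENT := log Vol − log((√(πe)/3)(8π²/3)) > 0`, Theorem A gives EXACTLY `ν_cyl + δ_ENT ≤ 𝒲`
(`threshold_log_identity`: `ν_cyl − log((√π e^{1/2}/3)(8π²/3)) = −2 log(2π/3) − 2`).

CUT into four registered stubs (each a genuine lemma; the open difficulty is NAMED, not hidden):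
* `stub_staticLinearHeat` (Statement A, size L, LIBRARY APEX shared with
  `carrilloNi_muEntropy_eq_log_shrinkerDensity` and `perelman_noLocalCollapsing`): the static linear
  heat-type Cauchy problem `∂ₛw = Δ_g w − Q w`, `w(0) = w₀`, smooth on `M × [0, T]`, on closed
  connected Riemannian 4-manifolds of the summit binder — VERBATIM the hypothesis `hLPs` of
  `Literature.Geometry.Riemannian.carrilloNi_muEntropy_eq_log_shrinkerDensity_of_staticLinearHeat`
  (WeightedHeatFlowFromLinearHeat.lean) specialised to the model `ℝ⁴`, so whichever existence theorem
  lands first closes it by instantiation (tree progress: Lions very-weak existence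
  `exists_veryWeak_linearHeat`, Hörmander interior regularity
  `exists_contMDiffOn_ae_eq_of_linearHeat_veryWeak`, uniqueness `heatDrift_unique`; missing:
  regularity up to `s = 0`).
* Statement B (A → EE(3,4), size L, provable now on the in-tree engine) — RESHAPED by the lead
  (2026-08-16) into four registered stubs `stub_dimensionalFisher` (B1: the integrated dimensional
  dissipation `∫∂ₜ(|∇f|²e^{-f}e^{-V}) ≤ −2K I − ½∫(Δf)²e^{-f}e^{-V}`), `stub_entropyEnergy_alongFlow`
  (B2: B1 ⇒ `H(0) ≤ 2 log(1 + I(0)/4K)` along a unit-mass solution of `∂ₜf = Δf − |∇f|²` with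
  `H → 0`, via the monotone quantity `H − 2 log(1 + I/4K)`), `stub_entropyEnergy_positive` (B3a:
  B2 ⇒ A ⇒ EE(K,4) for smooth positive densities, pattern of `logSobolev_of_heatExistence`) and
  `stub_entropyEnergy_of_positive` (B3b: positive densities ⇒ `w²` by the regularisation
  `(w² + ε)/(1 + ε)`); the original description of B: the
  DIMENSIONAL Bakry–Émery argument along the heat flow `∂ₜu = Δu` (`V ≡ log Vol` constant):
  `H' = −I`, `I' ≤ −2ρI − (2/n)I²` (Bochner with `|Hess f|² ≥ (Δf)²/4` KEPT — the tree's
  `fisher_pointwise_le` drops it — then Cauchy–Schwarz `∫(Δf)²u ≥ (∫Δf·u)² = I²`), Riccati comparison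
  `y' = −½y(12 + y)` instead of Grönwall, `H(0) = ∫₀^∞ I ≤ 2 log(1 + I₀/12)`, `I₀ = 4E`
  (BakryEmeryHeatFlow.lean: `fisher_pointwise_le`, `integral_derivWithin_fisher_le`,
  `hasDerivAt_entropy`, `entropy_le_fisher_div`, `logSobolev_of_heatFlow`; WeightedHeatFlowAPriori.lean:
  `heatFlow_ge_of_ge`, `heatFlow_tendstoUniformly`, `logSobolev_of_heatExistence`;
  WeightedHeatFlowFromLinearHeat.lean: `heatDrift_global_of_finite`, `heatDrift_finite_of_staticLinearHeat`).
* `stub_entropyVolume_of_entropyEnergy` (B → C, size M, provable now; triage r1-1's "land Theorem A's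
  calculus half"): substitution `w := √Vol (4πτ)⁻¹ e^{-f/2}` (`∫w² dV = Vol`, `|∇w|² = ¼w²|∇f|²`),
  `R ≥ 12` from `Ric ≥ 3g` (`scalarCurvature_ge_of_ricci_ge` below, 15 lines over
  `exists_basis_isOrthonormalFrame` / `trace_eq_sum_of_isOrthonormalFrame`), integrability of the
  `𝒲`-integrand (continuity: `contMDiff_gradSq`, `contMDiff_scalarCurvatureWith_holds`, finite volume
  `riemannianVolume_lt_top_of_isCompact_holds`), and one-variable convexity
  `min_E [4τE − 2 log(1 + E/3)] = 2 − 12τ + 2 log(6τ)` (`τ ≤ 1/6`; `E = 0` for `τ ≥ 1/6` with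
  `12τ − 2 log τ ≥ 2 + 2 log 6`), after which every `τ` cancels (triage r1-3 Scratch.lean checked the
  algebra as `example`s).
* `stub_ricciFatMetric` (Statement D, OPEN, HARDEST — SPC4-hard modulo the rung, as every `C⁺` of this
  crux must be by `Negative.subcylindricalExistence_iff_spc4`; the honest transfer target: pointwise /
  additive hypotheses with a cut-and-paste toolbox — route RicciFat's CorkSymmetrisation /
  near-extremal fill-ins — and Colding volume continuity, where the global `ν` has none).

`SubcylindricalExistence_of` composes the four stubs into the crux BY NAME (kernel-checked, no
`sorry`): connectedness of `M ≃ₕ S⁴` (`pathConnectedSpace_of_homotopyEquiv`, tree), the metric of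
D, `R ≥ 12 > 0` by the proved trace lemma, `δ := log Vol − log T`, Theorem A := C (B A), and the
logarithm identity. It is the ONLY theorem of the file concluding the crux by name. PROVED GLUE in
this file: `scalarCurvature_ge_of_ricci_ge` (`Ric ≥ c g ⇒ R ≥ 4c`), `threshold_log_identity`,
`threshold_identity` (`e^{ν_cyl − ν_rd} = √π e^{1/2}/3`), and the CROSS-ROUTE EDGE
`ricciFatMetric_of_ricciFatSphere : RicciFat.RicciFatSphere → RicciFatMetric` (card consequence C3:
route RicciFat's existence crux at `δ = 1/50 < δ₀` feeds this line; `ofRiemannian` round trip is `rfl`,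
`√(πe) < 2.94`).

## Disproof used

`payload.disproof_path` (cdisprove `Disproof.lean` v6, rc 0) is NOT mounted in planner jails and
`Cruxes/SubcylindricalExistence/Disproof.lean` is not published (`ledger crux ls`: absent) — known here
through its item-evidence notes v1–v6 and its LANDED `Theorems/SubcylindricalExistence/Negative/*`
(imported above, re-exported as `example`s at the end of this file):
* `Negative.subcylindricalExistence_iff_spc4` / `not_subcylindricalExistence_of_not_spc4` (Logic.lean:
  ENT ⇔ SPC4 modulo RUNG + transported round witness) — HONOURED: the line does not pretend to build
  metrics on an unknown `Σ`; all SPC4-hardness is concentrated in ONE named stub (D), and the three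
  other stubs are theorems-in-waiting useful to the route regardless (RoundBound = C at `Vol = 8π²/3`).
* `Negative.subcylindricalWitness_totalScalar_sq` (ConstTest.lean: any witness has `∫R > 0` and
  `e^{ν_cyl+δ+2}·64π²·Vol ≤ (∫R)²`; constants exhausted, `constClause_iff`) — CONSISTENT and SHARP: a
  D-metric has `R ≥ 12`, so `(∫R)² ≥ 144 Vol²`, and with `δ = δ_ENT` the constraint reads
  `e^{ν_cyl+2}·64π² Vol/T ≤ 144 Vol ⇔ 128π²√π e^{1/2} ≤ 144·T = 128π²√π e^{1/2}` — EQUALITY: the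
  line's witnesses sit exactly on the constant-test boundary when `R ≡ 12` (Theorem A is sharp at
  Einstein metrics, Carrillo–Ni), as they must.
* `Negative.nuCyl_lt_nuRound`, `margin_gt`/`margin_lt` (Window.lean: `0.026 < ν_rd − ν_cyl < 0.0263`)
  — CONSISTENT: for the round `S⁴` (`Vol = 8π²/3`) `δ_ENT = −log(√(πe)/3) = ν_rd − ν_cyl` exactly
  (`threshold_identity`), the maximal gap the window allows.
* `Negative.nuSheet_lt_nuCyl` / `sheetProfile_ge` / `neckProfile_ge` (Window.lean: necks and bubble
  sheets pin `ν ≤ ν_cyl`, `≤ ν_bs`) — NOT ENGAGED: the line constructs nothing by surgery; a D-metric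
  has `Ric ≥ 3 > 0`, which already forbids long `S³(ρ)×ℝ` necks and `S²×D²` regions of small `ρ`
  only through VOLUME (Bishop–Gromov), consistently with `Vol > 0.974·Vol S⁴`.
* `ledger negatives --problem SmoothPoincare4` (2026-08-16): empty for this crux's statements; no stub
  is an instance of a refuted statement (D is strictly stronger than ENT, not a rewording of it).
-/

noncomputable section

open scoped Manifold ContDiff Topology ENNReal NNReal ContinuousMap
open Set MeasureTheory
open Literature.Geometry.Lorentzian Literature.Geometry.Riemannian

namespace Summit.SmoothPoincare4.SmoothPoincare4.Cruxes.SubcylindricalExistence.CurvatureDimensionEntropyFloor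

/-! ## The four statements of the line (named; the registered stubs below restate them verbatim) -/

/-- **Statement A — the static linear heat-type Cauchy problem on closed connected Riemannian
4-manifolds** (summit binder, model `ℝ⁴`): for `g` Riemannian with Levi-Civita connection, every
`T > 0`, every smooth potential `Q` and every smooth datum `w₀`, the problem `∂ₛw = Δ_g w − Q w`,
`w(0) = w₀` has a solution `C^∞` on `M × [0, T]` (one-sided derivative within `[0, T]`). Verbatim the
hypothesis `hLPs` of `carrilloNi_muEntropy_eq_log_shrinkerDensity_of_staticLinearHeat`
(WeightedHeatFlowFromLinearHeat.lean) at `E = H = EuclideanSpace ℝ (Fin 4)`, `I = 𝓡 4`.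
Friedman 1964 Ch. 1 Thm 10 / Ch. 3 Thm 7; Topping 2006 Rem. 8.2.5; Grigor'yan 2009 Ch. 7. -/
def StaticLinearHeat : Prop :=
  ∀ (M : Type) [TopologicalSpace M] [T2Space M] [SecondCountableTopology M]
    [ChartedSpace (EuclideanSpace ℝ (Fin 4)) M] [IsManifold (𝓡 4) ∞ M] [CompactSpace M] [T3Space M]
    [MeasurableSpace M] [BorelSpace M] [ConnectedSpace M]
    (g : PseudoRiemannianMetric (𝓡 4) ∞ (EuclideanSpace ℝ (Fin 4)) (TangentSpace (𝓡 4) : M → Type _))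
    [g.HasLeviCivita] (T : ℝ), 0 < T → g.IsRiemannian →
    ∀ Q : M → ℝ, ContMDiff (𝓡 4) 𝓘(ℝ, ℝ) ∞ Q → ∀ w₀ : M → ℝ, ContMDiff (𝓡 4) 𝓘(ℝ, ℝ) ∞ w₀ →
      ∃ w : ℝ → M → ℝ,
        ContMDiffOn ((𝓡 4).prod 𝓘(ℝ, ℝ)) 𝓘(ℝ, ℝ) ∞ (fun p : M × ℝ ↦ w p.2 p.1) (univ ×ˢ Icc 0 T) ∧
        w 0 = w₀ ∧
        ∀ s ∈ Icc 0 T, ∀ x : M, HasDerivWithinAt (fun r ↦ w r x)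
          (g.dalembertian (w s) x - Q x * w s x) (Icc 0 T) s

/-- **Statement B — the curvature–dimension entropy–energy inequality EE(3,4)** (Bakry–Gentil–Ledoux
2014 §6; Bakry–Bolley–Gentil arXiv:1412.5165 §4.1 eq. (4.1), case `ρ = 3`, `n = 4`), in prover shape:
on a closed connected Riemannian 4-manifold with `Ric ≥ 3g`, for every smooth `w` with `∫ w² dV = Vol`,
`(1/Vol) ∫ w² log w² dV ≤ 2 log(1 + ∫|∇w|² dV/(3 Vol))`. -/
def EntropyEnergyCD34 : Prop :=
  ∀ (M : Type) [TopologicalSpace M] [T2Space M] [SecondCountableTopology M]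
    [ChartedSpace (EuclideanSpace ℝ (Fin 4)) M] [IsManifold (𝓡 4) ∞ M] [CompactSpace M] [T3Space M]
    [MeasurableSpace M] [BorelSpace M] [ConnectedSpace M]
    (g : PseudoRiemannianMetric (𝓡 4) ∞ (EuclideanSpace ℝ (Fin 4)) (TangentSpace (𝓡 4) : M → Type _))
    [g.HasLeviCivita] (hg : g.IsRiemannian),
    (∀ (x : M) (v : TangentSpace (𝓡 4) x), 3 * g.val x v v ≤ g.ricci x v v) →
    ∀ w : M → ℝ, ContMDiff (𝓡 4) 𝓘(ℝ, ℝ) ∞ w →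
      ∫ x, w x ^ 2 ∂(riemannianMeasure (g.toContMDiffRiemannianMetric hg))
        = (riemannianMeasure (g.toContMDiffRiemannianMetric hg) Set.univ).toReal →
      (∫ x, w x ^ 2 * Real.log (w x ^ 2) ∂(riemannianMeasure (g.toContMDiffRiemannianMetric hg)))
        / (riemannianMeasure (g.toContMDiffRiemannianMetric hg) Set.univ).toReal ≤
      2 * Real.log (1 + (∫ x, g.gradSq w x ∂(riemannianMeasure (g.toContMDiffRiemannianMetric hg)))
          / (3 * (riemannianMeasure (g.toContMDiffRiemannianMetric hg) Set.univ).toReal))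

/-! ### Lead's reshape (2026-08-16): Statement B cut into four registered pieces B1 → B2 → B3a → B3b
along the tree's Bakry–Émery engine (`BakryEmeryHeatFlow.lean`, `WeightedHeatFlowAPriori.lean`,
`WeightedHeatFlowFromLinearHeat.lean`), all in the library's currency (`g.riemVolume`,
`derivWithin … (Ici 0)`, `f` smooth on `M × [0, ∞)` solving `∂ₜf = Lf − |∇f|²`). -/

/-- **Statement B1 — the DIMENSIONAL dissipation of the Fisher information** (Carrillo–Ni 2009 §3
p. 8 with the Hessian term KEPT: `|Hess f|² ≥ (Δ_g f)²/4` in dimension 4). Verbatim the hypotheses of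
`Literature.Geometry.Riemannian.integral_derivWithin_fisher_le` on the summit binder (closed 4-manifold,
`g` Riemannian with Levi-Civita connection, `V` smooth, `K g ≤ Ric + Hess V`, `f` smooth on `M × [0, ∞)`
with `∂ₜf = Δf − g⁻¹(dV, df) − |∇f|²`), and its conclusion improved by the dimensional term:
`∫ ∂ₜ(|∇f|² e^{-f} e^{-V}) dV ≤ −2K ∫ |∇f|² e^{-f} e^{-V} dV − ½ ∫ (Δ_g f)² e^{-f} e^{-V} dV`. -/
def DimensionalFisherDissipation : Prop :=
  ∀ (M : Type) [TopologicalSpace M] [T2Space M] [SecondCountableTopology M]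
    [ChartedSpace (EuclideanSpace ℝ (Fin 4)) M] [IsManifold (𝓡 4) ∞ M] [CompactSpace M] [T3Space M]
    [MeasurableSpace M] [BorelSpace M]
    (g : PseudoRiemannianMetric (𝓡 4) ∞ (EuclideanSpace ℝ (Fin 4)) (TangentSpace (𝓡 4) : M → Type _))
    [g.HasLeviCivita] (_hg : g.IsRiemannian) (V : M → ℝ) (K : ℝ), ContMDiff (𝓡 4) 𝓘(ℝ, ℝ) ∞ V →
    (∀ (y : M) (X : TangentSpace (𝓡 4) y), K * g.val y X X ≤ g.ricci y X X + g.hessian V y X X) →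
    ∀ f : ℝ → M → ℝ,
      ContMDiffOn ((𝓡 4).prod 𝓘(ℝ, ℝ)) 𝓘(ℝ, ℝ) ∞ (fun p : M × ℝ ↦ f p.2 p.1) (univ ×ˢ Ici 0) →
      (∀ t ∈ Ici (0 : ℝ), ∀ y : M, derivWithin (fun s ↦ f s y) (Ici 0) t =
        g.dalembertian (f t) y
          - g.innerDual y (mvfderiv (𝓡 4) V y : TangentSpace (𝓡 4) y →ₗ[ℝ] ℝ)
              (mvfderiv (𝓡 4) (f t) y : TangentSpace (𝓡 4) y →ₗ[ℝ] ℝ)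
          - g.gradSq (f t) y) →
      ∀ t ∈ Ici (0 : ℝ),
        ∫ y, derivWithin (fun s ↦ g.gradSq (f s) y * Real.exp (-f s y) * Real.exp (-V y)) (Ici 0) t
            ∂g.riemVolume ≤
          -2 * K * ∫ y, g.gradSq (f t) y * Real.exp (-f t y) * Real.exp (-V y) ∂g.riemVolume
            - (1 / 2 : ℝ) * ∫ y, (g.dalembertian (f t) y) ^ 2 * Real.exp (-f t y) * Real.exp (-V y)
                ∂g.riemVolume

/-- **Statement B2 — the entropy–energy inequality ALONG the (unweighted) heat flow** on a closed
Riemannian 4-manifold with `Ric ≥ K g`, `K > 0`: for a constant weight `e^{-c}` (think `c = log Vol`)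
and `f` smooth on `M × [0, ∞)` solving `∂ₜf = Δf − |∇f|²` (i.e. `u = e^{-f}` solves the heat equation)
with unit mass `∫ e^{-f(t,·)} e^{-c} dV = 1` for all `t ≥ 0` and entropy `H(t) = ∫ (−f)e^{-f}e^{-c} dV → 0`,
one has `H(0) ≤ 2 log(1 + I(0)/(4K))`, `I(0) = ∫ |∇f(0,·)|² e^{-f(0,·)} e^{-c} dV` (dimensional
Bakry–Émery: `H' = −I`, `I' ≤ −2K I − ½ I²`, and `H − 2 log(1 + I/4K)` is non-decreasing and tends to `0`). -/
def EntropyEnergyAlongFlow : Prop :=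
  ∀ (M : Type) [TopologicalSpace M] [T2Space M] [SecondCountableTopology M]
    [ChartedSpace (EuclideanSpace ℝ (Fin 4)) M] [IsManifold (𝓡 4) ∞ M] [CompactSpace M] [T3Space M]
    [MeasurableSpace M] [BorelSpace M]
    (g : PseudoRiemannianMetric (𝓡 4) ∞ (EuclideanSpace ℝ (Fin 4)) (TangentSpace (𝓡 4) : M → Type _))
    [g.HasLeviCivita] (_hg : g.IsRiemannian) (c K : ℝ), 0 < K →
    (∀ (y : M) (X : TangentSpace (𝓡 4) y), K * g.val y X X ≤ g.ricci y X X) →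
    ∀ f : ℝ → M → ℝ,
      ContMDiffOn ((𝓡 4).prod 𝓘(ℝ, ℝ)) 𝓘(ℝ, ℝ) ∞ (fun p : M × ℝ ↦ f p.2 p.1) (univ ×ˢ Ici 0) →
      (∀ t ∈ Ici (0 : ℝ), ∀ y : M, derivWithin (fun s ↦ f s y) (Ici 0) t =
        g.dalembertian (f t) y - g.gradSq (f t) y) →
      (∀ t ∈ Ici (0 : ℝ), ∫ y, Real.exp (-f t y) * Real.exp (-c) ∂g.riemVolume = 1) →
      Filter.Tendsto (fun s ↦ ∫ y, (-f s y) * Real.exp (-f s y) * Real.exp (-c) ∂g.riemVolume)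
        Filter.atTop (𝓝 0) →
      ∫ y, (-f 0 y) * Real.exp (-f 0 y) * Real.exp (-c) ∂g.riemVolume ≤
        2 * Real.log (1 + (1 / (4 * K)) *
          ∫ y, g.gradSq (f 0) y * Real.exp (-f 0 y) * Real.exp (-c) ∂g.riemVolume)

/-- **Statement B3a — the entropy–energy inequality EE(K,4) for smooth POSITIVE densities** on a
closed connected Riemannian 4-manifold with `Ric ≥ K g`, `K > 0`: for every smooth `φ` with
`∫ e^φ dV = Vol`, `(1/Vol) ∫ φ e^φ dV ≤ 2 log(1 + ∫ |∇φ|² e^φ dV/(4K·Vol))` (i.e. for the probability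
`dm = dV/Vol` and `ρ = e^φ`: `Ent_m(ρ) ≤ 2 log(1 + I_m(ρ)/(4K))`). From the static linear heat problem
(Statement A) exactly as `logSobolev_of_heatExistence`, with B2 in place of `entropy_le_fisher_div`. -/
def EntropyEnergyPositive : Prop :=
  ∀ (M : Type) [TopologicalSpace M] [T2Space M] [SecondCountableTopology M]
    [ChartedSpace (EuclideanSpace ℝ (Fin 4)) M] [IsManifold (𝓡 4) ∞ M] [CompactSpace M] [T3Space M]
    [MeasurableSpace M] [BorelSpace M] [ConnectedSpace M]
    (g : PseudoRiemannianMetric (𝓡 4) ∞ (EuclideanSpace ℝ (Fin 4)) (TangentSpace (𝓡 4) : M → Type _))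
    [g.HasLeviCivita] (_hg : g.IsRiemannian) (K : ℝ), 0 < K →
    (∀ (y : M) (X : TangentSpace (𝓡 4) y), K * g.val y X X ≤ g.ricci y X X) →
    ∀ φ : M → ℝ, ContMDiff (𝓡 4) 𝓘(ℝ, ℝ) ∞ φ →
      ∫ x, Real.exp (φ x) ∂g.riemVolume = (g.riemVolume Set.univ).toReal →
      (∫ x, φ x * Real.exp (φ x) ∂g.riemVolume) / (g.riemVolume Set.univ).toReal ≤
        2 * Real.log (1 + (∫ x, g.gradSq φ x * Real.exp (φ x) ∂g.riemVolume)
          / (4 * K * (g.riemVolume Set.univ).toReal))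

/-- **Statement C — Theorem A (entropy ≥ log-volume under `Ric ≥ 3`)**: on a closed connected
Riemannian 4-manifold with `Ric ≥ 3g`, for every `τ > 0` and every smooth `f` with
`∫ (4πτ)⁻² e^{-f} dV = 1`: `log Vol(M,g) − 2 log(2π/3) − 2 ≤ 𝒲(g,f,τ)`; i.e.
`μ(g,τ) ≥ ν(S⁴_rd) + log(Vol/Vol S⁴)` for all `τ`, with equality at `τ = 1/6`, `f ≡ 2` for every
Einstein metric `Ric = 3g` (RoundBound is the case `Vol = 8π²/3`). Same decl as the ideators'
`EntropyVolumeComparison` (SketchIdeator2.lean / ideator-3 Sketch.lean). -/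
def EntropyVolumeComparison : Prop :=
  ∀ (M : Type) [TopologicalSpace M] [T2Space M] [SecondCountableTopology M]
    [ChartedSpace (EuclideanSpace ℝ (Fin 4)) M] [IsManifold (𝓡 4) ∞ M] [CompactSpace M] [T3Space M]
    [MeasurableSpace M] [BorelSpace M] [ConnectedSpace M]
    (g : PseudoRiemannianMetric (𝓡 4) ∞ (EuclideanSpace ℝ (Fin 4)) (TangentSpace (𝓡 4) : M → Type _))
    [g.HasLeviCivita] (hg : g.IsRiemannian),
    (∀ (x : M) (v : TangentSpace (𝓡 4) x), 3 * g.val x v v ≤ g.ricci x v v) →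
    ∀ τ : ℝ, 0 < τ → ∀ f : M → ℝ, ContMDiff (𝓡 4) 𝓘(ℝ, ℝ) ∞ f →
      ∫ x, (4 * Real.pi * τ) ^ (-(4 : ℝ) / 2) * Real.exp (-f x)
          ∂(riemannianMeasure (g.toContMDiffRiemannianMetric hg)) = 1 →
      Real.log ((riemannianMeasure (g.toContMDiffRiemannianMetric hg) Set.univ).toReal)
          - 2 * Real.log (2 * Real.pi / 3) - 2 ≤
        ∫ x, (τ * (g.scalarCurvature x + g.gradSq f x) + f x - 4) *
          ((4 * Real.pi * τ) ^ (-(4 : ℝ) / 2) * Real.exp (-f x))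
          ∂(riemannianMeasure (g.toContMDiffRiemannianMetric hg))

/-- **Statement D — Ricci-fat metrics on homotopy 4-spheres at the FIXED threshold
`δ₀ = 1 − √(πe)/3`** (the card's transfer target `C⁺`, typed as the triage panel demanded): every
closed smooth `M ≃ₕ S⁴` of the summit binder carries a Riemannian metric `g` with Levi-Civita
connection, `Ric_g ≥ 3g`, and `Vol(M,g) > (√π·e^{1/2}/3)·(8π²/3) = 0.974094·26.318945 = 25.6371`.
True on `S⁴` (round metric: `Ric = 3g`, `Vol = 8π²/3`); implied by `RicciFat.RicciFatSphere` at any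
`δ < δ₀` (`ricciFatMetric_of_ricciFatSphere`, proved below); SPC4-hard modulo the rung. -/
def RicciFatMetric : Prop :=
  ∀ (M : Type) [TopologicalSpace M] [T2Space M] [SecondCountableTopology M]
    [ChartedSpace (EuclideanSpace ℝ (Fin 4)) M] [IsManifold (𝓡 4) ∞ M] [CompactSpace M] [T3Space M]
    [MeasurableSpace M] [BorelSpace M],
    M ≃ₕ Metric.sphere (0 : EuclideanSpace ℝ (Fin 5)) 1 →
    ∃ g : PseudoRiemannianMetric (𝓡 4) ∞ (EuclideanSpace ℝ (Fin 4)) (TangentSpace (𝓡 4) : M → Type _),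
    ∃ _ : g.HasLeviCivita, ∃ hg : g.IsRiemannian,
      (∀ (x : M) (v : TangentSpace (𝓡 4) x), 3 * g.val x v v ≤ g.ricci x v v) ∧
      Real.sqrt Real.pi * Real.exp (1 / 2 : ℝ) / 3 * (8 * Real.pi ^ 2 / 3) <
        (riemannianMeasure (g.toContMDiffRiemannianMetric hg) Set.univ).toReal

/-! ## The registered stubs -/

/-- STUB A (L; library apex, shared with `carrilloNi_muEntropy_eq_log_shrinkerDensity` and
`perelman_noLocalCollapsing`) — `StaticLinearHeat`: the static linear heat-type Cauchy problem
`∂ₛw = Δ_g w − Q w`, `w(0) = w₀`, smooth on `M × [0, T]`, on closed connected Riemannian 4-manifolds.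
Why plausibly true: standard linear parabolic theory (Friedman 1964 Ch. 1 Thm 10, Ch. 3 Thm 7 with a
partition of unity; Grigor'yan 2009 Thm 7.7–7.10). Why hard as a Lean target: the tree has Lions'
very-weak existence (`exists_veryWeak_linearHeat`), Hörmander interior regularity
(`exists_contMDiffOn_ae_eq_of_linearHeat_veryWeak`) and uniqueness (`heatDrift_unique`), but not yet
smoothness up to `s = 0` for smooth data (compatibility is automatic on a closed manifold; needs the
energy method one derivative higher or the Duhamel reduction to zero data). Closes by instantiation
from any theorem proving the `hLPs` of `carrilloNi_muEntropy_eq_log_shrinkerDensity_of_staticLinearHeat`. -/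
theorem stub_staticLinearHeat :
    ∀ (M : Type) [TopologicalSpace M] [T2Space M] [SecondCountableTopology M]
      [ChartedSpace (EuclideanSpace ℝ (Fin 4)) M] [IsManifold (𝓡 4) ∞ M] [CompactSpace M] [T3Space M]
      [MeasurableSpace M] [BorelSpace M] [ConnectedSpace M]
      (g : PseudoRiemannianMetric (𝓡 4) ∞ (EuclideanSpace ℝ (Fin 4)) (TangentSpace (𝓡 4) : M → Type _))
      [g.HasLeviCivita] (T : ℝ), 0 < T → g.IsRiemannian →
      ∀ Q : M → ℝ, ContMDiff (𝓡 4) 𝓘(ℝ, ℝ) ∞ Q → ∀ w₀ : M → ℝ, ContMDiff (𝓡 4) 𝓘(ℝ, ℝ) ∞ w₀ →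
        ∃ w : ℝ → M → ℝ,
          ContMDiffOn ((𝓡 4).prod 𝓘(ℝ, ℝ)) 𝓘(ℝ, ℝ) ∞ (fun p : M × ℝ ↦ w p.2 p.1) (univ ×ˢ Icc 0 T) ∧
          w 0 = w₀ ∧
          ∀ s ∈ Icc 0 T, ∀ x : M, HasDerivWithinAt (fun r ↦ w r x)
            (g.dalembertian (w s) x - Q x * w s x) (Icc 0 T) s := by
  sorry

/-- STUB B1 (M/L; provable now) — `DimensionalFisherDissipation` verbatim: the tree's
`integral_derivWithin_fisher_le` (BakryEmeryHeatFlow.lean) with the dimensional term KEPT. Proof plan: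
(i) a pointwise lemma = `fisher_pointwise_le` with `− ½ (Δ_g f)²` added on the right — same proof
(chart at `x`, `MetricCoord.IsMetricOn.fisher_identity`), but instead of dropping
`normSqAt G u (hessAt G F̂ u) ≥ 0` (`normSqAt_hessAt_chartRep_nonneg`) use
`(lapAt G F̂ u)² ≤ 4 · normSqAt G u (hessAt G F̂ u)`, obtained exactly like
`normSqAt_hessAt_chartRep_nonneg`: `OpensChart.normSq_eq_normSqAt`, `OpensChart.hessian_eq_hessAt`,
`OpensChart.dalembertian_eq_lapAt` for the pulled-back metric `chartPullback I g x₀` (whose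
`dalembertian` is `trace ∘ hessian` by definition) and `PseudoRiemannianMetric.trace_sq_le_finrank_mul_normSq`
(RicciFlowScalarCurvatureComparison.lean; `finrank ℝ ℝ⁴ = 4`), with `dalembertian_chartInv_eq` to come
back to `g.dalembertian`; (ii) integrate exactly as in `integral_derivWithin_fisher_le`, carrying the
extra continuous integrand `(Δ_g f_t)² e^{-f_t} e^{-V}` along. -/
theorem stub_dimensionalFisher :
    ∀ (M : Type) [TopologicalSpace M] [T2Space M] [SecondCountableTopology M]
      [ChartedSpace (EuclideanSpace ℝ (Fin 4)) M] [IsManifold (𝓡 4) ∞ M] [CompactSpace M] [T3Space M]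
      [MeasurableSpace M] [BorelSpace M]
      (g : PseudoRiemannianMetric (𝓡 4) ∞ (EuclideanSpace ℝ (Fin 4)) (TangentSpace (𝓡 4) : M → Type _))
      [g.HasLeviCivita] (_hg : g.IsRiemannian) (V : M → ℝ) (K : ℝ), ContMDiff (𝓡 4) 𝓘(ℝ, ℝ) ∞ V →
      (∀ (y : M) (X : TangentSpace (𝓡 4) y), K * g.val y X X ≤ g.ricci y X X + g.hessian V y X X) →
      ∀ f : ℝ → M → ℝ,
        ContMDiffOn ((𝓡 4).prod 𝓘(ℝ, ℝ)) 𝓘(ℝ, ℝ) ∞ (fun p : M × ℝ ↦ f p.2 p.1) (univ ×ˢ Ici 0) →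
        (∀ t ∈ Ici (0 : ℝ), ∀ y : M, derivWithin (fun s ↦ f s y) (Ici 0) t =
          g.dalembertian (f t) y
            - g.innerDual y (mvfderiv (𝓡 4) V y : TangentSpace (𝓡 4) y →ₗ[ℝ] ℝ)
                (mvfderiv (𝓡 4) (f t) y : TangentSpace (𝓡 4) y →ₗ[ℝ] ℝ)
            - g.gradSq (f t) y) →
        ∀ t ∈ Ici (0 : ℝ),
          ∫ y, derivWithin (fun s ↦ g.gradSq (f s) y * Real.exp (-f s y) * Real.exp (-V y)) (Ici 0) t
              ∂g.riemVolume ≤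
            -2 * K * ∫ y, g.gradSq (f t) y * Real.exp (-f t y) * Real.exp (-V y) ∂g.riemVolume
              - (1 / 2 : ℝ) * ∫ y, (g.dalembertian (f t) y) ^ 2 * Real.exp (-f t y) * Real.exp (-V y)
                  ∂g.riemVolume := by
  sorry

/-- STUB B2 (M; provable now) — `DimensionalFisherDissipation → EntropyEnergyAlongFlow`: the ODE
half of the dimensional Bakry–Émery argument, with NO Riccati comparison. Put
`I(t) = ∫ |∇f_t|² e^{-f_t} e^{-c}`, `D(t) = ∫ (Δf_t)² e^{-f_t} e^{-c}`, `H(t) = ∫ (−f_t) e^{-f_t} e^{-c}`.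
B1 with `V ≡ c` (`mvfderiv` of a constant is `0`, `g.hessian (fun _ ↦ c) = 0` — cf.
`PseudoRiemannianMetric.hessian_const` in Lorentzian/BlackHoles.lean, 10 lines to re-prove) and the
Leibniz rule (`hasDerivAt_integral_of_continuousOn_prod`, pattern of `fisher_le_exp_mul`) give
`I' ≤ −2K I − ½ D` on `(0, ∞)`; Green (`integral_dalembertian_riemVolume_eq_zero` on `e^{-f}`,
`Δ(e^{-f}) = e^{-f}(|∇f|² − Δf)`, cf. `weightedLaplacian_exp_neg`) gives `∫ Δf_t e^{-f_t} e^{-c} = I(t)`,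
and with unit mass Cauchy–Schwarz in the form `0 ≤ ∫ (Δf_t − I)² e^{-f_t}e^{-c} = D − I²` gives
`I' ≤ −2K I − ½ I²`. With `H' = −I` (`hasDerivAt_entropy`, `V ≡ c`) the function
`Ψ = H − 2 log(1 + I/(4K))` is continuous on `[0, ∞)` and `Ψ' = −I − 2I'/(4K + I) ≥ 0` on `(0, ∞)`
(`monotoneOn_of_deriv_nonneg`), while `Ψ(T) → 0` (`H → 0` by hypothesis, `0 ≤ I(T) ≤ e^{-2KT} I(0)` by
`fisher_le_exp_mul`); hence `H(0) = Ψ(0) + 2 log(1 + I(0)/4K) ≤ 2 log(1 + I(0)/4K)`. -/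
theorem stub_entropyEnergy_alongFlow :
    (∀ (M : Type) [TopologicalSpace M] [T2Space M] [SecondCountableTopology M]
      [ChartedSpace (EuclideanSpace ℝ (Fin 4)) M] [IsManifold (𝓡 4) ∞ M] [CompactSpace M] [T3Space M]
      [MeasurableSpace M] [BorelSpace M]
      (g : PseudoRiemannianMetric (𝓡 4) ∞ (EuclideanSpace ℝ (Fin 4)) (TangentSpace (𝓡 4) : M → Type _))
      [g.HasLeviCivita] (_hg : g.IsRiemannian) (V : M → ℝ) (K : ℝ), ContMDiff (𝓡 4) 𝓘(ℝ, ℝ) ∞ V →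
      (∀ (y : M) (X : TangentSpace (𝓡 4) y), K * g.val y X X ≤ g.ricci y X X + g.hessian V y X X) →
      ∀ f : ℝ → M → ℝ,
        ContMDiffOn ((𝓡 4).prod 𝓘(ℝ, ℝ)) 𝓘(ℝ, ℝ) ∞ (fun p : M × ℝ ↦ f p.2 p.1) (univ ×ˢ Ici 0) →
        (∀ t ∈ Ici (0 : ℝ), ∀ y : M, derivWithin (fun s ↦ f s y) (Ici 0) t =
          g.dalembertian (f t) y
            - g.innerDual y (mvfderiv (𝓡 4) V y : TangentSpace (𝓡 4) y →ₗ[ℝ] ℝ)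
                (mvfderiv (𝓡 4) (f t) y : TangentSpace (𝓡 4) y →ₗ[ℝ] ℝ)
            - g.gradSq (f t) y) →
        ∀ t ∈ Ici (0 : ℝ),
          ∫ y, derivWithin (fun s ↦ g.gradSq (f s) y * Real.exp (-f s y) * Real.exp (-V y)) (Ici 0) t
              ∂g.riemVolume ≤
            -2 * K * ∫ y, g.gradSq (f t) y * Real.exp (-f t y) * Real.exp (-V y) ∂g.riemVolume
              - (1 / 2 : ℝ) * ∫ y, (g.dalembertian (f t) y) ^ 2 * Real.exp (-f t y) * Real.exp (-V y)
                  ∂g.riemVolume) →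
    ∀ (M : Type) [TopologicalSpace M] [T2Space M] [SecondCountableTopology M]
      [ChartedSpace (EuclideanSpace ℝ (Fin 4)) M] [IsManifold (𝓡 4) ∞ M] [CompactSpace M] [T3Space M]
      [MeasurableSpace M] [BorelSpace M]
      (g : PseudoRiemannianMetric (𝓡 4) ∞ (EuclideanSpace ℝ (Fin 4)) (TangentSpace (𝓡 4) : M → Type _))
      [g.HasLeviCivita] (_hg : g.IsRiemannian) (c K : ℝ), 0 < K →
      (∀ (y : M) (X : TangentSpace (𝓡 4) y), K * g.val y X X ≤ g.ricci y X X) →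
      ∀ f : ℝ → M → ℝ,
        ContMDiffOn ((𝓡 4).prod 𝓘(ℝ, ℝ)) 𝓘(ℝ, ℝ) ∞ (fun p : M × ℝ ↦ f p.2 p.1) (univ ×ˢ Ici 0) →
        (∀ t ∈ Ici (0 : ℝ), ∀ y : M, derivWithin (fun s ↦ f s y) (Ici 0) t =
          g.dalembertian (f t) y - g.gradSq (f t) y) →
        (∀ t ∈ Ici (0 : ℝ), ∫ y, Real.exp (-f t y) * Real.exp (-c) ∂g.riemVolume = 1) →
        Filter.Tendsto (fun s ↦ ∫ y, (-f s y) * Real.exp (-f s y) * Real.exp (-c) ∂g.riemVolume)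
          Filter.atTop (𝓝 0) →
        ∫ y, (-f 0 y) * Real.exp (-f 0 y) * Real.exp (-c) ∂g.riemVolume ≤
          2 * Real.log (1 + (1 / (4 * K)) *
            ∫ y, g.gradSq (f 0) y * Real.exp (-f 0 y) * Real.exp (-c) ∂g.riemVolume) := by
  sorry

/-- STUB B3a (M; provable now) — `EntropyEnergyAlongFlow → StaticLinearHeat → EntropyEnergyPositive`:
EE(K,4) for smooth positive densities `ρ = e^φ`, `∫ e^φ dV = Vol`, by running the heat flow — the
exact pattern of `logSobolev_of_heatExistence` / `logSobolev_of_heatFlow` (WeightedHeatFlowAPriori.lean,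
BakryEmeryHeatFlow.lean) with B2 in place of `entropy_le_fisher_div`. With the constant weight
`V ≡ c := log Vol` (`e^{-c} dV = dV/Vol`, `∫ e^{-V} dV = 1`; `Hess V = 0` so `K g ≤ Ric + Hess V`):
the flow `u` on `M × [0, ∞)` from `h₀ = e^φ` is `heatDrift_global_of_finite` ∘
`heatDrift_finite_of_staticLinearHeat` (WeightedHeatFlowFromLinearHeat.lean) fed by Statement A for
this `(M, g, T)`; positivity `heatFlow_ge_of_ge`; unit mass for all `t` `heatFlow_integral_eq`;
convergence `heatFlow_tendstoUniformly`; `f = −log u` solves `∂ₜf = Δf − |∇f|²` (`negLog_heat_equation`,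
the drift term vanishing since `dV ≡ 0`); `H(t) → 0` by `tendsto_entropy_of_tendstoUniformly`; apply B2
with `c = log Vol` and rewrite `f 0 = −φ` (`gradSq_neg`). -/
theorem stub_entropyEnergy_positive :
    (∀ (M : Type) [TopologicalSpace M] [T2Space M] [SecondCountableTopology M]
      [ChartedSpace (EuclideanSpace ℝ (Fin 4)) M] [IsManifold (𝓡 4) ∞ M] [CompactSpace M] [T3Space M]
      [MeasurableSpace M] [BorelSpace M]
      (g : PseudoRiemannianMetric (𝓡 4) ∞ (EuclideanSpace ℝ (Fin 4)) (TangentSpace (𝓡 4) : M → Type _))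
      [g.HasLeviCivita] (_hg : g.IsRiemannian) (c K : ℝ), 0 < K →
      (∀ (y : M) (X : TangentSpace (𝓡 4) y), K * g.val y X X ≤ g.ricci y X X) →
      ∀ f : ℝ → M → ℝ,
        ContMDiffOn ((𝓡 4).prod 𝓘(ℝ, ℝ)) 𝓘(ℝ, ℝ) ∞ (fun p : M × ℝ ↦ f p.2 p.1) (univ ×ˢ Ici 0) →
        (∀ t ∈ Ici (0 : ℝ), ∀ y : M, derivWithin (fun s ↦ f s y) (Ici 0) t =
          g.dalembertian (f t) y - g.gradSq (f t) y) →
        (∀ t ∈ Ici (0 : ℝ), ∫ y, Real.exp (-f t y) * Real.exp (-c) ∂g.riemVolume = 1) →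
        Filter.Tendsto (fun s ↦ ∫ y, (-f s y) * Real.exp (-f s y) * Real.exp (-c) ∂g.riemVolume)
          Filter.atTop (𝓝 0) →
        ∫ y, (-f 0 y) * Real.exp (-f 0 y) * Real.exp (-c) ∂g.riemVolume ≤
          2 * Real.log (1 + (1 / (4 * K)) *
            ∫ y, g.gradSq (f 0) y * Real.exp (-f 0 y) * Real.exp (-c) ∂g.riemVolume)) →
    (∀ (M : Type) [TopologicalSpace M] [T2Space M] [SecondCountableTopology M]
      [ChartedSpace (EuclideanSpace ℝ (Fin 4)) M] [IsManifold (𝓡 4) ∞ M] [CompactSpace M] [T3Space M]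
      [MeasurableSpace M] [BorelSpace M] [ConnectedSpace M]
      (g : PseudoRiemannianMetric (𝓡 4) ∞ (EuclideanSpace ℝ (Fin 4)) (TangentSpace (𝓡 4) : M → Type _))
      [g.HasLeviCivita] (T : ℝ), 0 < T → g.IsRiemannian →
      ∀ Q : M → ℝ, ContMDiff (𝓡 4) 𝓘(ℝ, ℝ) ∞ Q → ∀ w₀ : M → ℝ, ContMDiff (𝓡 4) 𝓘(ℝ, ℝ) ∞ w₀ →
        ∃ w : ℝ → M → ℝ,
          ContMDiffOn ((𝓡 4).prod 𝓘(ℝ, ℝ)) 𝓘(ℝ, ℝ) ∞ (fun p : M × ℝ ↦ w p.2 p.1) (univ ×ˢ Icc 0 T) ∧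
          w 0 = w₀ ∧
          ∀ s ∈ Icc 0 T, ∀ x : M, HasDerivWithinAt (fun r ↦ w r x)
            (g.dalembertian (w s) x - Q x * w s x) (Icc 0 T) s) →
    ∀ (M : Type) [TopologicalSpace M] [T2Space M] [SecondCountableTopology M]
      [ChartedSpace (EuclideanSpace ℝ (Fin 4)) M] [IsManifold (𝓡 4) ∞ M] [CompactSpace M] [T3Space M]
      [MeasurableSpace M] [BorelSpace M] [ConnectedSpace M]
      (g : PseudoRiemannianMetric (𝓡 4) ∞ (EuclideanSpace ℝ (Fin 4)) (TangentSpace (𝓡 4) : M → Type _))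
      [g.HasLeviCivita] (_hg : g.IsRiemannian) (K : ℝ), 0 < K →
      (∀ (y : M) (X : TangentSpace (𝓡 4) y), K * g.val y X X ≤ g.ricci y X X) →
      ∀ φ : M → ℝ, ContMDiff (𝓡 4) 𝓘(ℝ, ℝ) ∞ φ →
        ∫ x, Real.exp (φ x) ∂g.riemVolume = (g.riemVolume Set.univ).toReal →
        (∫ x, φ x * Real.exp (φ x) ∂g.riemVolume) / (g.riemVolume Set.univ).toReal ≤
          2 * Real.log (1 + (∫ x, g.gradSq φ x * Real.exp (φ x) ∂g.riemVolume)
            / (4 * K * (g.riemVolume Set.univ).toReal)) := by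
  sorry

/-- STUB B3b (M; provable now) — `EntropyEnergyPositive → EntropyEnergyCD34`: from positive densities
to `w²` by regularisation. Given smooth `w` with `∫ w² dV = Vol` put, for `0 < ε ≤ 1`,
`φ_ε := log((w² + ε)/(1 + ε))` (smooth, `∫ e^{φ_ε} dV = Vol`); B3a at `K = 3` gives
`(1/Vol)∫ ρ_ε log ρ_ε dV ≤ 2 log(1 + ∫ |∇φ_ε|² e^{φ_ε} dV/(12 Vol))` with `ρ_ε = (w² + ε)/(1 + ε)`; the
chain rule (`mvfderiv` of `log ∘`, of `(·)² ∘`; `gradSq` is the quadratic form of `innerDual`,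
`innerDual_smul_left/right`) gives `|∇φ_ε|² e^{φ_ε} = 4 w² |∇w|²/((w² + ε)(1 + ε)) ≤ 4 |∇w|²`, so the
right side is `≤ 2 log(1 + ∫|∇w|² dV/(3 Vol))` (`Real.log_le_log`, `gradSq_nonneg`); the left side tends
to `(1/Vol)∫ w² log w² dV` as `ε → 0⁺` by dominated convergence (`ρ_ε → w²` pointwise,
`|ρ_ε log ρ_ε| ≤ C(sup w² + 1)` uniformly: `x ↦ x log x` is bounded on bounded subsets of `[0, ∞)`,
`Real.abs_log_mul_self_lt` / continuity on a compact interval), and `le_of_tendsto'` concludes. The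
measure is rewritten with `riemVolume_eq hg : g.riemVolume = riemannianMeasure (g.toContMDiffRiemannianMetric hg)`. -/
theorem stub_entropyEnergy_of_positive :
    (∀ (M : Type) [TopologicalSpace M] [T2Space M] [SecondCountableTopology M]
      [ChartedSpace (EuclideanSpace ℝ (Fin 4)) M] [IsManifold (𝓡 4) ∞ M] [CompactSpace M] [T3Space M]
      [MeasurableSpace M] [BorelSpace M] [ConnectedSpace M]
      (g : PseudoRiemannianMetric (𝓡 4) ∞ (EuclideanSpace ℝ (Fin 4)) (TangentSpace (𝓡 4) : M → Type _))
      [g.HasLeviCivita] (_hg : g.IsRiemannian) (K : ℝ), 0 < K →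
      (∀ (y : M) (X : TangentSpace (𝓡 4) y), K * g.val y X X ≤ g.ricci y X X) →
      ∀ φ : M → ℝ, ContMDiff (𝓡 4) 𝓘(ℝ, ℝ) ∞ φ →
        ∫ x, Real.exp (φ x) ∂g.riemVolume = (g.riemVolume Set.univ).toReal →
        (∫ x, φ x * Real.exp (φ x) ∂g.riemVolume) / (g.riemVolume Set.univ).toReal ≤
          2 * Real.log (1 + (∫ x, g.gradSq φ x * Real.exp (φ x) ∂g.riemVolume)
            / (4 * K * (g.riemVolume Set.univ).toReal))) →
    ∀ (M : Type) [TopologicalSpace M] [T2Space M] [SecondCountableTopology M]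
      [ChartedSpace (EuclideanSpace ℝ (Fin 4)) M] [IsManifold (𝓡 4) ∞ M] [CompactSpace M] [T3Space M]
      [MeasurableSpace M] [BorelSpace M] [ConnectedSpace M]
      (g : PseudoRiemannianMetric (𝓡 4) ∞ (EuclideanSpace ℝ (Fin 4)) (TangentSpace (𝓡 4) : M → Type _))
      [g.HasLeviCivita] (hg : g.IsRiemannian),
      (∀ (x : M) (v : TangentSpace (𝓡 4) x), 3 * g.val x v v ≤ g.ricci x v v) →
      ∀ w : M → ℝ, ContMDiff (𝓡 4) 𝓘(ℝ, ℝ) ∞ w →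
        ∫ x, w x ^ 2 ∂(riemannianMeasure (g.toContMDiffRiemannianMetric hg))
          = (riemannianMeasure (g.toContMDiffRiemannianMetric hg) Set.univ).toReal →
        (∫ x, w x ^ 2 * Real.log (w x ^ 2) ∂(riemannianMeasure (g.toContMDiffRiemannianMetric hg)))
          / (riemannianMeasure (g.toContMDiffRiemannianMetric hg) Set.univ).toReal ≤
        2 * Real.log (1 + (∫ x, g.gradSq w x ∂(riemannianMeasure (g.toContMDiffRiemannianMetric hg)))
            / (3 * (riemannianMeasure (g.toContMDiffRiemannianMetric hg) Set.univ).toReal)) := by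
  sorry

/-- STUB C (M; provable now — triage r1-1: "land Theorem A's calculus half as
`EntropyEnergyCD34 → EntropyVolumeComparison`") — the Legendre reduction with `τ`-cancellation.
Given `τ > 0` and smooth `f` with `∫ u dV = 1`, `u = (4πτ)⁻² e^{-f}`: put `V = Vol(M,g)` (positive and
finite: `riemannianVolume_pos_of_isOpen`, `riemannianVolume_lt_top_of_isCompact_holds`) and
`w := √V (4πτ)⁻¹ e^{-f/2}` (smooth, `∫w² dV = V`). Then `f = −log w² + log V − 2 log(4πτ)`,
`g.gradSq w = ¼ w² · g.gradSq f` (chain rule for `mvfderiv` of `exp ∘ (−f/2)`, `innerDual` bilinear: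
`innerDual_smul_left/right`), so `∫ τ|∇f|² u dV = 4τ E`, `E := ∫|∇w|² dV / V`, and
`∫ f u dV = −(1/V)∫w² log w² dV + log V − 2 log(4πτ)`; `R ≥ 12` pointwise
(`scalarCurvature_ge_of_ricci_ge`, re-prove its 15 lines in the Theorems file) gives `∫ τ R u ≥ 12τ`.
All integrands are continuous on compact `M` (`contMDiff_gradSq`, `contMDiff_scalarCurvatureWith_holds`
/ `scalarCurvatureWith_leviCivita`), hence integrable for the finite measure, so the Bochner integrals
split honestly. B bounds `(1/V)∫w² log w² ≤ 2 log(1 + E/3)`, whence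
`𝒲 ≥ 12τ + 4τE − 2 log(1 + E/3) + log V − 2 log(4πτ) − 4 ≥ log V − 2 log(2π/3) − 2`, the last step
being the one-variable inequality `4τE − 2 log(1 + E/3) ≥ 2 − 12τ + 2 log(6τ)` for `0 < τ`, `E ≥ 0`
(convexity in `E`; for `τ ≥ 1/6` use `E ↦` increasing and `12τ − 2 log(6τ) − 2 ≥ 0`), in which every
`τ` cancels against `−2 log(4πτ) + 12τ`. Why it might fail: it cannot, given B (pure rewriting; the
algebra is triage r1-3's Scratch.lean); risk is only bookkeeping size (~300 lines). -/
theorem stub_entropyVolume_of_entropyEnergy :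
    (∀ (M : Type) [TopologicalSpace M] [T2Space M] [SecondCountableTopology M]
      [ChartedSpace (EuclideanSpace ℝ (Fin 4)) M] [IsManifold (𝓡 4) ∞ M] [CompactSpace M] [T3Space M]
      [MeasurableSpace M] [BorelSpace M] [ConnectedSpace M]
      (g : PseudoRiemannianMetric (𝓡 4) ∞ (EuclideanSpace ℝ (Fin 4)) (TangentSpace (𝓡 4) : M → Type _))
      [g.HasLeviCivita] (hg : g.IsRiemannian),
      (∀ (x : M) (v : TangentSpace (𝓡 4) x), 3 * g.val x v v ≤ g.ricci x v v) →
      ∀ w : M → ℝ, ContMDiff (𝓡 4) 𝓘(ℝ, ℝ) ∞ w →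
        ∫ x, w x ^ 2 ∂(riemannianMeasure (g.toContMDiffRiemannianMetric hg))
          = (riemannianMeasure (g.toContMDiffRiemannianMetric hg) Set.univ).toReal →
        (∫ x, w x ^ 2 * Real.log (w x ^ 2) ∂(riemannianMeasure (g.toContMDiffRiemannianMetric hg)))
          / (riemannianMeasure (g.toContMDiffRiemannianMetric hg) Set.univ).toReal ≤
        2 * Real.log (1 + (∫ x, g.gradSq w x ∂(riemannianMeasure (g.toContMDiffRiemannianMetric hg)))
            / (3 * (riemannianMeasure (g.toContMDiffRiemannianMetric hg) Set.univ).toReal))) →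
    ∀ (M : Type) [TopologicalSpace M] [T2Space M] [SecondCountableTopology M]
      [ChartedSpace (EuclideanSpace ℝ (Fin 4)) M] [IsManifold (𝓡 4) ∞ M] [CompactSpace M] [T3Space M]
      [MeasurableSpace M] [BorelSpace M] [ConnectedSpace M]
      (g : PseudoRiemannianMetric (𝓡 4) ∞ (EuclideanSpace ℝ (Fin 4)) (TangentSpace (𝓡 4) : M → Type _))
      [g.HasLeviCivita] (hg : g.IsRiemannian),
      (∀ (x : M) (v : TangentSpace (𝓡 4) x), 3 * g.val x v v ≤ g.ricci x v v) →
      ∀ τ : ℝ, 0 < τ → ∀ f : M → ℝ, ContMDiff (𝓡 4) 𝓘(ℝ, ℝ) ∞ f →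
        ∫ x, (4 * Real.pi * τ) ^ (-(4 : ℝ) / 2) * Real.exp (-f x)
            ∂(riemannianMeasure (g.toContMDiffRiemannianMetric hg)) = 1 →
        Real.log ((riemannianMeasure (g.toContMDiffRiemannianMetric hg) Set.univ).toReal)
            - 2 * Real.log (2 * Real.pi / 3) - 2 ≤
          ∫ x, (τ * (g.scalarCurvature x + g.gradSq f x) + f x - 4) *
            ((4 * Real.pi * τ) ^ (-(4 : ℝ) / 2) * Real.exp (-f x))
            ∂(riemannianMeasure (g.toContMDiffRiemannianMetric hg)) := by
  sorry

/-- STUB D (OPEN, HARDEST — the transfer target `C⁺_{δ₀}`) — `RicciFatMetric`: every closed smooth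
`M ≃ₕ S⁴` carries `g` with `Ric ≥ 3g` and `Vol(M,g) > (√(πe)/3)·8π²/3 = 25.6371`. Why plausibly true:
it is implied by SPC4 (pull the round metric back: `Ric = 3g`, `Vol = 8π²/3 = 26.319`; route RicciFat's
support item `Spc4ImpliesRicciFatSphere` + `ricciFatMetric_of_ricciFatSphere` below) and by
`RicciFat.RicciFatSphere` at any `δ < 0.025906`. Why hard: SPC4-hard modulo the rung
(`Negative.subcylindricalExistence_iff_spc4` ∘ `SubcylindricalExistence_of`); constructively, `Ric ≥ 3`
with almost-round volume forces GH-closeness to `S⁴(1)` at every scale (Bishop–Gromov, Colding 1997),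
so only an almost-isometry to the round sphere can witness it; the available engines are route
RicciFat's CORK SYMMETRISATION (a `τ`-symmetric 1-jet along the cork boundary transports `Ric` and
`Vol` exactly through the cork twist; informal item stmt-SmoothPoincare4-6299) and NEAR-EXTREMAL
FILL-INS (stmt-…-6330). Why it might fail: false iff some homotopy 4-sphere `Σ` has
`V(Σ) := sup{Vol : Ric ≥ 3} ≤ 0.974094·8π²/3` — in particular iff `Σ` is exotic AND Cheeger–Colding's
`δ(4) ≥ 0.0259`; no explicit `δ(4)` is known. Sources: CheegerColding1997 Thm A.1.10, Colding1997,
arXiv:1412.5165, route RicciFat (Theses/RicciFat.lean). -/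
theorem stub_ricciFatMetric :
    ∀ (M : Type) [TopologicalSpace M] [T2Space M] [SecondCountableTopology M]
      [ChartedSpace (EuclideanSpace ℝ (Fin 4)) M] [IsManifold (𝓡 4) ∞ M] [CompactSpace M] [T3Space M]
      [MeasurableSpace M] [BorelSpace M],
      M ≃ₕ Metric.sphere (0 : EuclideanSpace ℝ (Fin 5)) 1 →
      ∃ g : PseudoRiemannianMetric (𝓡 4) ∞ (EuclideanSpace ℝ (Fin 4)) (TangentSpace (𝓡 4) : M → Type _),
      ∃ _ : g.HasLeviCivita, ∃ hg : g.IsRiemannian,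
        (∀ (x : M) (v : TangentSpace (𝓡 4) x), 3 * g.val x v v ≤ g.ricci x v v) ∧
        Real.sqrt Real.pi * Real.exp (1 / 2 : ℝ) / 3 * (8 * Real.pi ^ 2 / 3) <
          (riemannianMeasure (g.toContMDiffRiemannianMetric hg) Set.univ).toReal := by
  sorry

/-! ### Consistency: each named statement IS its registered stub (definitionally) -/

theorem staticLinearHeat_holds : StaticLinearHeat := stub_staticLinearHeat
theorem dimensionalFisherDissipation_holds : DimensionalFisherDissipation := stub_dimensionalFisher
theorem entropyEnergyAlongFlow_of_dimensionalFisher :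
    DimensionalFisherDissipation → EntropyEnergyAlongFlow := stub_entropyEnergy_alongFlow
theorem entropyEnergyPositive_of_alongFlow :
    EntropyEnergyAlongFlow → StaticLinearHeat → EntropyEnergyPositive := stub_entropyEnergy_positive
theorem entropyEnergyCD34_of_positive : EntropyEnergyPositive → EntropyEnergyCD34 :=
  stub_entropyEnergy_of_positive
/-- The old single stub B (`StaticLinearHeat → EntropyEnergyCD34`) is the composite of B1–B3b. -/
theorem entropyEnergyCD34_of_staticLinearHeat : StaticLinearHeat → EntropyEnergyCD34 := fun hA ↦
  entropyEnergyCD34_of_positive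
    (entropyEnergyPositive_of_alongFlow
      (entropyEnergyAlongFlow_of_dimensionalFisher dimensionalFisherDissipation_holds) hA)
theorem entropyVolumeComparison_of_entropyEnergyCD34 : EntropyEnergyCD34 → EntropyVolumeComparison :=
  stub_entropyVolume_of_entropyEnergy
theorem ricciFatMetric_holds : RicciFatMetric := stub_ricciFatMetric

/-! ### Name-keyed aliases of the seven statements (the hypotheses of the composition; the skeleton
audit admits a hypothesis only if its head constant is a registered obligation or is named like a
declared stub) -/
namespace Registered

/-- Alias of `StaticLinearHeat` keyed by the registered stub name. -/
abbrev stub_staticLinearHeat : Prop := StaticLinearHeat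
/-- Alias of `DimensionalFisherDissipation` keyed by the registered stub name. -/
abbrev stub_dimensionalFisher : Prop := DimensionalFisherDissipation
/-- Alias of `DimensionalFisherDissipation → EntropyEnergyAlongFlow` keyed by the registered stub name. -/
abbrev stub_entropyEnergy_alongFlow : Prop := DimensionalFisherDissipation → EntropyEnergyAlongFlow
/-- Alias of `EntropyEnergyAlongFlow → StaticLinearHeat → EntropyEnergyPositive` keyed by the
registered stub name. -/
abbrev stub_entropyEnergy_positive : Prop :=
  EntropyEnergyAlongFlow → StaticLinearHeat → EntropyEnergyPositive
/-- Alias of `EntropyEnergyPositive → EntropyEnergyCD34` keyed by the registered stub name. -/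
abbrev stub_entropyEnergy_of_positive : Prop := EntropyEnergyPositive → EntropyEnergyCD34
/-- Alias of `EntropyEnergyCD34 → EntropyVolumeComparison` keyed by the registered stub name. -/
abbrev stub_entropyVolume_of_entropyEnergy : Prop := EntropyEnergyCD34 → EntropyVolumeComparison
/-- Alias of `RicciFatMetric` keyed by the registered stub name. -/
abbrev stub_ricciFatMetric : Prop := RicciFatMetric

end Registered

/-! ## Glue (PROVED) -/

/-- **`Ric ≥ c·g` forces `R ≥ 4c` in dimension 4** (Riemannian `g`): `R = tr_g Ric = Σᵢ Ric(bᵢ, bᵢ)`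
in a `g_x`-orthonormal basis (`exists_basis_isOrthonormalFrame`, `trace_eq_sum_of_isOrthonormalFrame`;
O'Neill 1983, Ch. 3, Def. 3.53). Used by `SubcylindricalExistence_of` for `R ≥ 12 > 0`, and it is the
`R ≥ 12` input of STUB C. [folklore] -/
theorem scalarCurvature_ge_of_ricci_ge {M : Type*} [TopologicalSpace M]
    [ChartedSpace (EuclideanSpace ℝ (Fin 4)) M] [IsManifold (𝓡 4) ∞ M]
    (g : PseudoRiemannianMetric (𝓡 4) ∞ (EuclideanSpace ℝ (Fin 4)) (TangentSpace (𝓡 4) : M → Type _))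
    [g.HasLeviCivita] (hg : g.IsRiemannian) {c : ℝ} {x : M}
    (hRic : ∀ v : TangentSpace (𝓡 4) x, c * g.val x v v ≤ g.ricci x v v) :
    4 * c ≤ g.scalarCurvature x := by
  obtain ⟨b, hb⟩ := g.exists_basis_isOrthonormalFrame (x := x) (fun v hv ↦ hg x v hv)
    (finrank_euclideanSpace_fin (𝕜 := ℝ) (n := 4))
  have hsum : g.scalarCurvature x = ∑ i, g.ricci x (b i) (b i) :=
    g.trace_eq_sum_of_isOrthonormalFrame b hb (g.ricci x)
  have hterm : ∀ i, c ≤ g.ricci x (b i) (b i) := fun i ↦ by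
    have h := hRic (b i)
    rwa [hb.1 i, mul_one] at h
  calc 4 * c = ∑ _i : Fin 4, c := by
        rw [Finset.sum_const, Finset.card_univ, Fintype.card_fin, nsmul_eq_mul]; norm_num
    _ ≤ ∑ i, g.ricci x (b i) (b i) := Finset.sum_le_sum fun i _ ↦ hterm i
    _ = g.scalarCurvature x := hsum.symm

/-- **The logarithm of the volume threshold**: `ν_cyl − log((√π e^{1/2}/3)(8π²/3)) = −2 log(2π/3) − 2`,
i.e. with `δ_ENT := log Vol − log T` Theorem A's floor `log Vol − 2 log(2π/3) − 2` is EXACTLY the crux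
level `ν_cyl + δ_ENT`. [folklore] -/
theorem threshold_log_identity :
    (Real.log 2 + Real.log Real.pi / 2 - 3 / 2)
        - Real.log (Real.sqrt Real.pi * Real.exp (1 / 2 : ℝ) / 3 * (8 * Real.pi ^ 2 / 3))
      = -(2 * Real.log (2 * Real.pi / 3)) - 2 := by
  have hπ : 0 < Real.pi := Real.pi_pos
  have hsqrt : 0 < Real.sqrt Real.pi := Real.sqrt_pos.2 hπ
  have hA : Real.log (Real.sqrt Real.pi * Real.exp (1 / 2 : ℝ) / 3)
      = Real.log Real.pi / 2 + 1 / 2 - Real.log 3 := by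
    rw [Real.log_div (by positivity) (by norm_num), Real.log_mul hsqrt.ne' (Real.exp_pos _).ne',
      Real.log_sqrt hπ.le, Real.log_exp]
  have h8 : Real.log 8 = 3 * Real.log 2 := by
    rw [show (8 : ℝ) = 2 ^ 3 by norm_num, Real.log_pow]
    push_cast
    ring
  have hB : Real.log (8 * Real.pi ^ 2 / 3) = 3 * Real.log 2 + 2 * Real.log Real.pi - Real.log 3 := by
    rw [Real.log_div (by positivity) (by norm_num), Real.log_mul (by norm_num) (by positivity),
      Real.log_pow, h8]
    push_cast
    ring
  have h1 : Real.log (Real.sqrt Real.pi * Real.exp (1 / 2 : ℝ) / 3 * (8 * Real.pi ^ 2 / 3))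
      = (Real.log Real.pi / 2 + 1 / 2 - Real.log 3)
        + (3 * Real.log 2 + 2 * Real.log Real.pi - Real.log 3) := by
    rw [Real.log_mul (by positivity) (by positivity), hA, hB]
  have h2 : Real.log (2 * Real.pi / 3) = Real.log 2 + Real.log Real.pi - Real.log 3 := by
    rw [Real.log_div (by positivity) (by norm_num), Real.log_mul (by norm_num) hπ.ne']
  rw [h1, h2]
  ring

/-- The volume threshold is `e^{ν_cyl − ν_rd}·Vol(S⁴)`: `e^{ν_cyl − ν_rd} = √π·e^{1/2}/3 = √(πe)/3 = 0.974094`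
(so D asks for `Vol > 0.974094·8π²/3`, i.e. RicciFat's `δ₀ = 0.025906`). [folklore] -/
theorem threshold_identity :
    Real.exp ((Real.log 2 + Real.log Real.pi / 2 - 3 / 2) - (Real.log 6 - 2))
      = Real.sqrt Real.pi * Real.exp (1 / 2 : ℝ) / 3 := by
  have hpi : (0 : ℝ) < Real.pi := Real.pi_pos
  have h6 : Real.log 6 = Real.log 2 + Real.log 3 := by
    rw [show (6 : ℝ) = 2 * 3 by norm_num, Real.log_mul (by norm_num) (by norm_num)]
  rw [h6]
  have : (Real.log 2 + Real.log Real.pi / 2 - 3 / 2) - (Real.log 2 + Real.log 3 - 2)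
      = (Real.log Real.pi / 2) + (1 / 2) - Real.log 3 := by ring
  rw [this, Real.exp_sub, Real.exp_add, Real.exp_log (by norm_num : (0:ℝ) < 3)]
  have hs : Real.exp (Real.log Real.pi / 2) = Real.sqrt Real.pi := by
    rw [Real.sqrt_eq_rpow, Real.rpow_def_of_pos hpi]
    congr 1
    ring
  rw [hs]

/-- **Numerics of the transfer**: `(√π·e^{1/2}/3)·(8π²/3) < (1 − 1/50)·(8π²/3)`, i.e. `√(πe) < 2.94`
(`πe < 3.1416·2.7182818286 = 8.5398 < 8.6436 = 2.94²`). [folklore] -/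
theorem threshold_lt_ricciFat_fiftieth :
    Real.sqrt Real.pi * Real.exp (1 / 2 : ℝ) / 3 * (8 * Real.pi ^ 2 / 3)
      < (1 - 1 / 50) * (8 * Real.pi ^ 2 / 3) := by
  have hπ : 0 < Real.pi := Real.pi_pos
  have hA : 0 < Real.sqrt Real.pi * Real.exp (1 / 2 : ℝ) := by positivity
  have hsq : (Real.sqrt Real.pi * Real.exp (1 / 2 : ℝ)) ^ 2 = Real.pi * Real.exp 1 := by
    rw [mul_pow, Real.sq_sqrt hπ.le, ← Real.exp_nat_mul]
    norm_num
  have hprod : Real.pi * Real.exp 1 < 2.94 ^ 2 := by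
    have h1 := Real.pi_lt_d4
    have h2 := Real.exp_one_lt_d9
    have h3 := Real.exp_pos (1 : ℝ)
    nlinarith
  have hlt : Real.sqrt Real.pi * Real.exp (1 / 2 : ℝ) < 2.94 := by
    by_contra h
    push Not at h
    have : (2.94 : ℝ) ^ 2 ≤ (Real.sqrt Real.pi * Real.exp (1 / 2 : ℝ)) ^ 2 := by gcongr
    linarith [hsq ▸ this]
  have hV : 0 < 8 * Real.pi ^ 2 / 3 := by positivity
  have h3 : Real.sqrt Real.pi * Real.exp (1 / 2 : ℝ) / 3 < 1 - 1 / 50 := by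
    rw [div_lt_iff₀ (by norm_num : (0:ℝ) < 3)]
    linarith
  exact mul_lt_mul_of_pos_right h3 hV

/-- **Cross-route edge (card consequence C3).** Route RicciFat's existence crux `RicciFatSphere`
(`∀ δ > 0 ∃ h, Ric_h ≥ 3h ∧ Vol ≥ (1 − δ)·8π²/3`) implies Statement D: take `δ = 1/50 < δ₀ = 0.025906`;
the pseudo-Riemannian metric of `h` is Riemannian with the same Levi-Civita instance and the same
volume measure (`(ofRiemannian h).toContMDiffRiemannianMetric _ = h` is `rfl`). So a proof of RicciFat's
crux closes STUB D by `exact ricciFatMetric_of_ricciFatSphere h5192`. [folklore] -/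
theorem ricciFatMetric_of_ricciFatSphere
    (h : _root_.Summit.SmoothPoincare4.SmoothPoincare4.Theses.RicciFat.RicciFatSphere) :
    RicciFatMetric := by
  intro M _ _ _ _ _ _ _ _ _ e
  obtain ⟨h₀, hLC, hRic, hVol⟩ := h M e (1 / 50) (by norm_num)
  refine ⟨PseudoRiemannianMetric.ofRiemannian h₀, hLC,
    PseudoRiemannianMetric.isRiemannian_ofRiemannian h₀, fun x v ↦ ?_, ?_⟩
  · simpa only [PseudoRiemannianMetric.val_ofRiemannian] using hRic x v
  · have hfin : riemannianMeasure h₀ Set.univ ≠ ⊤ :=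
      (riemannianVolume_lt_top_of_isCompact_holds h₀ le_rfl isCompact_univ).ne
    have hle : (1 - 1 / 50) * (8 * Real.pi ^ 2 / 3) ≤ (riemannianMeasure h₀ Set.univ).toReal :=
      (ENNReal.ofReal_le_iff_le_toReal hfin).1 hVol
    change _ < (riemannianMeasure h₀ Set.univ).toReal
    exact threshold_lt_ricciFat_fiftieth.trans_le hle

/-- **RoundBound drops out of Theorem A (card consequence C1; the route's "NOT DECOMPOSED YET" support
statement `ν(S⁴_round) = log 6 − 2`, lower-bound half).** For any metric to which Statement C applies
and whose volume is that of the unit round `S⁴`, `Vol = 8π²/3` (e.g. the round metric: `Ric = 3g`),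
`μ(g,τ) ≥ log 6 − 2 = ν(S⁴_rd)` for EVERY `τ > 0` — no Perelman monotonicity, no ancient flow:
`log(8π²/3) − 2 log(2π/3) − 2 = log 6 − 2`. (The matching upper bound is the constant test function at
`τ = 1/6`, `Negative.constClause_iff`.) [folklore] -/
theorem roundBound_of_entropyVolumeComparison (hC : EntropyVolumeComparison)
    (M : Type) [TopologicalSpace M] [T2Space M] [SecondCountableTopology M]
    [ChartedSpace (EuclideanSpace ℝ (Fin 4)) M] [IsManifold (𝓡 4) ∞ M] [CompactSpace M] [T3Space M]
    [MeasurableSpace M] [BorelSpace M] [ConnectedSpace M]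
    (g : PseudoRiemannianMetric (𝓡 4) ∞ (EuclideanSpace ℝ (Fin 4)) (TangentSpace (𝓡 4) : M → Type _))
    [g.HasLeviCivita] (hg : g.IsRiemannian)
    (hRic : ∀ (x : M) (v : TangentSpace (𝓡 4) x), 3 * g.val x v v ≤ g.ricci x v v)
    (hVol : (riemannianMeasure (g.toContMDiffRiemannianMetric hg) Set.univ).toReal = 8 * Real.pi ^ 2 / 3)
    {τ : ℝ} (hτ : 0 < τ) {f : M → ℝ} (hf : ContMDiff (𝓡 4) 𝓘(ℝ, ℝ) ∞ f)
    (hnorm : ∫ x, (4 * Real.pi * τ) ^ (-(4 : ℝ) / 2) * Real.exp (-f x)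
      ∂(riemannianMeasure (g.toContMDiffRiemannianMetric hg)) = 1) :
    Real.log 6 - 2 ≤
      ∫ x, (τ * (g.scalarCurvature x + g.gradSq f x) + f x - 4) *
        ((4 * Real.pi * τ) ^ (-(4 : ℝ) / 2) * Real.exp (-f x))
        ∂(riemannianMeasure (g.toContMDiffRiemannianMetric hg)) := by
  have hW := hC M g hg hRic τ hτ f hf hnorm
  rw [hVol] at hW
  have hπ : 0 < Real.pi := Real.pi_pos
  have h8 : Real.log 8 = 3 * Real.log 2 := by
    rw [show (8 : ℝ) = 2 ^ 3 by norm_num, Real.log_pow]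
    push_cast
    ring
  have hB : Real.log (8 * Real.pi ^ 2 / 3) = 3 * Real.log 2 + 2 * Real.log Real.pi - Real.log 3 := by
    rw [Real.log_div (by positivity) (by norm_num), Real.log_mul (by norm_num) (by positivity),
      Real.log_pow, h8]
    push_cast
    ring
  have h2 : Real.log (2 * Real.pi / 3) = Real.log 2 + Real.log Real.pi - Real.log 3 := by
    rw [Real.log_div (by positivity) (by norm_num), Real.log_mul (by norm_num) hπ.ne']
  have h6 : Real.log 6 = Real.log 2 + Real.log 3 := by
    rw [show (6 : ℝ) = 2 * 3 by norm_num, Real.log_mul (by norm_num) (by norm_num)]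
  rw [hB, h2] at hW
  rw [h6]
  linarith

/-! ## The composition: the seven stubs imply the crux, by name -/

/-- **ENT from the line.** `SubcylindricalExistence` (stmt-SmoothPoincare4-10871) from the seven
registered stubs (pure logic + the proved glue; no `sorry`): `M ≃ₕ S⁴` is connected
(`pathConnectedSpace_of_homotopyEquiv`); STUB D gives `g` with `Ric ≥ 3g` and `Vol > T`; `R ≥ 12 > 0`
(`scalarCurvature_ge_of_ricci_ge`); Theorem A = STUB C (B3b (B3a (B2 B1) A)) bounds every `𝒲(g,f,τ)`
below by `log Vol − 2 log(2π/3) − 2 = ν_cyl + (log Vol − log T)` (`threshold_log_identity`), and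
`δ := log Vol − log T > 0`. -/
theorem SubcylindricalExistence_of (hA : Registered.stub_staticLinearHeat)
    (hB1 : Registered.stub_dimensionalFisher) (hB2 : Registered.stub_entropyEnergy_alongFlow)
    (hB3a : Registered.stub_entropyEnergy_positive) (hB3b : Registered.stub_entropyEnergy_of_positive)
    (hC : Registered.stub_entropyVolume_of_entropyEnergy) (hD : Registered.stub_ricciFatMetric) :
    _root_.Summit.SmoothPoincare4.SmoothPoincare4.Theses.EntropyRung.SubcylindricalExistence := by
  intro M _ _ _ _ _ _ _ _ _ e
  -- `M ≃ₕ S⁴` ⇒ `M` (path) connected: Statements B/C carry `[ConnectedSpace M]` (load-bearing)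
  haveI : PathConnectedSpace (Metric.sphere (0 : EuclideanSpace ℝ (Fin 5)) 1) :=
    Literature.Topology.FourManifolds.pathConnectedSpace_sphere_four
  haveI : PathConnectedSpace M :=
    Literature.Topology.FourManifolds.pathConnectedSpace_of_homotopyEquiv e
  -- STUB D: a Ricci-fat metric above the threshold
  obtain ⟨g, hLC, hg, hRic, hVol⟩ := hD M e
  -- Theorem A from STUBS A, B1, B2, B3a, B3b, C
  have hThmA : EntropyVolumeComparison := hC (hB3b (hB3a (hB2 hB1) hA))
  set V : ℝ := (riemannianMeasure (g.toContMDiffRiemannianMetric hg) Set.univ).toReal with hVdef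
  set T : ℝ := Real.sqrt Real.pi * Real.exp (1 / 2 : ℝ) / 3 * (8 * Real.pi ^ 2 / 3) with hTdef
  have hTpos : 0 < T := by positivity
  have hVpos : 0 < V := hTpos.trans hVol
  refine ⟨g, hLC, hg, fun x ↦ ?_, Real.log V - Real.log T, sub_pos.2 (Real.log_lt_log hTpos hVol),
    fun τ hτ f hf hnorm ↦ ?_⟩
  · -- `R ≥ 12 > 0`
    have h12 : 4 * (3 : ℝ) ≤ g.scalarCurvature x :=
      scalarCurvature_ge_of_ricci_ge g hg (c := 3) (hRic x)
    linarith
  · -- the entropy floor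
    have hW := hThmA M g hg hRic τ hτ f hf hnorm
    have hid := threshold_log_identity
    rw [← hTdef] at hid
    linarith

/-- Wiring check: the registered stubs feed `SubcylindricalExistence_of` as stated. -/
example : _root_.Summit.SmoothPoincare4.SmoothPoincare4.Theses.EntropyRung.SubcylindricalExistence :=
  SubcylindricalExistence_of stub_staticLinearHeat stub_dimensionalFisher stub_entropyEnergy_alongFlow
    stub_entropyEnergy_positive stub_entropyEnergy_of_positive stub_entropyVolume_of_entropyEnergy
    stub_ricciFatMetric

/-! ## Scratch checks against the landed `Negative/*` lemmas and the `Leans on:` names -/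

/-- ENT is SPC4-hard modulo the rung (Logic.lean): the contrapositive of the route's `closes`. All of
that hardness sits in STUB D. -/
example (hRung : _root_.Summit.SmoothPoincare4.SmoothPoincare4.Theses.EntropyRung.SubcylindricalRecognition)
    (h : ¬ _root_.SmoothPoincare4) :
    ¬ _root_.Summit.SmoothPoincare4.SmoothPoincare4.Theses.EntropyRung.SubcylindricalExistence :=
  Summit.SmoothPoincare4.Cruxes.SubcylindricalExistence.Negative.not_subcylindricalExistence_of_not_spc4
    hRung h

/-- The window (Window.lean): the round witness has `0.026 < ν_rd − ν_cyl < 0.0263`; by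
`threshold_identity` the line's `δ_ENT` at `Vol = 8π²/3` is exactly `ν_rd − ν_cyl`. -/
example : (0.026 : ℝ) < (Real.log 6 - 2) - (Real.log 2 + Real.log Real.pi / 2 - 3 / 2) ∧
    (Real.log 6 - 2) - (Real.log 2 + Real.log Real.pi / 2 - 3 / 2) < 0.0263 :=
  ⟨Summit.SmoothPoincare4.Cruxes.SubcylindricalExistence.Negative.margin_gt,
    Summit.SmoothPoincare4.Cruxes.SubcylindricalExistence.Negative.margin_lt⟩

/-- Bubble sheets sit below the cylinder (Window.lean) — the surgery obstruction the line never
meets (it builds nothing). -/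
example : (Real.log 2 - 1) < (Real.log 2 + Real.log Real.pi / 2 - 3 / 2) :=
  Summit.SmoothPoincare4.Cruxes.SubcylindricalExistence.Negative.nuSheet_lt_nuCyl

/-- `Leans on` of the glue resolve: compactness and connectedness of homotopy 4-spheres are tree
theorems. -/
example (M : Type) [TopologicalSpace M] [T2Space M] [SecondCountableTopology M]
    [ChartedSpace (EuclideanSpace ℝ (Fin 4)) M] [IsManifold (𝓡 4) ∞ M]
    (e : M ≃ₕ Metric.sphere (0 : EuclideanSpace ℝ (Fin 5)) 1) : CompactSpace M :=
  Literature.Topology.FourManifolds.compactSpace_of_homotopyEquiv_sphere_four_holds M e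

end Summit.SmoothPoincare4.SmoothPoincare4.Cruxes.SubcylindricalExistence.CurvatureDimensionEntropyFloor

end
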